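import Literature.MathematicalPhysics.QuantumLattice.FockGaugeRotation
import Literature.MathematicalPhysics.QuantumLattice.HubbardNNNHoppingVariationalWindowCertificate
import Literature.MathematicalPhysics.QuantumLattice.HubbardNNNHoppingPairCorrelatorD4Certificate
import HarnessLib

/-!
# The gauge-twisted space group of the square torus (`B₁g` twist)

For a `d_{x²−y²}` (`B₁g`) pair field `Δ = Σ_x Φ_x` the quarter turn `R` of the lattice acts as `Δ ↦ −Δ`,
and so does the gauge half-turn restricted to charge `±2` (`c ↦ i c` gives `Δ ↦ −Δ`). The product
`R ∘ 𝒢` (`𝒢 = e^{iπN̂/2}`, `FockGaugeRotation.fockGauge 1`) therefore FIXES `Δ`: the symmetry group of a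
gauge-broken `d`-wave one-point programme is not `(ℤ/L)² ⋊ D₄` but its TWIST — translations, the
`b₁g`-even elements `{1, R², σ, σR²}` acting plainly, the `b₁g`-odd ones `{R, R³, σR, σR³}` composed
with `𝒢` (hubbard-obs PAIRCORR-SDP §13.2/§13.14: the identification under which eng-2's twisted
one-point objects are built, ×3.8 fewer variables than the `D₂` export). This file types that unitary
family on the Fock space of the `L × L` torus and the facts the orbit-state certificate reader
(`OrbitStateVariationalCertificate.re_orbitState_ge_of_variational_certificate_ineq`) asks of an
averaging family:

* `b1gTwist γ ∈ {0, 1}` (the `B₁g` character as an exponent: `b1gSign γ = (−1)^{b1gTwist γ}`),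
  `twistCarry`, `b1gTwist_add` (character law with carry);
* `twistedSpaceGroupUnitary S : ((ℤ/L)² × S) × Fin 2 → unitaries`,
  `T(v, γ, m) = U_v D_γ 𝒢_{b1gTwist γ + 2m}` (the `Fin 2` surplus `𝒢_2 = (−1)^{N̂}` makes the family
  exactly closed under multiplication);
* `twistedSpaceGroupUnitary_conjTranspose_mul_self` (unitary), `…_mul_hubbardTorusTT'` (commutes with
  the `t–t'` Hubbard Hamiltonian), `…_commute_spinNumber` (with `N_σ`), `…_closed` (closure under right
  multiplication by any member, `S` closed under multiplication), `…_closed_translate` (by translations,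
  `1 ∈ S`);
* `fockGauge_commute_spaceGroupUnitary` (the gauge rotation is central in the space group).

Everything is PROVED; no named fact. Bratteli–Robinson II §5.2.2 / §6.2.4 (gauge group; group averages),
Han (2020) §3 (lattice symmetries of the bootstrap), Scalapino (1995) §2 (the `B₁g` form factor).

References: O. Bratteli, D. W. Robinson, *Operator Algebras and Quantum Statistical Mechanics 2*,
§5.2.2, §6.2.4 [BratteliRobinsonII1997]; X. Han, arXiv:2006.06002 §3 [Han2020Bootstrap]; D. J. Scalapino,
Phys. Rep. 250 (1995) 329, §2 eq. (2.3) [Scalapino1995].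
-/

noncomputable section

namespace Literature.MathematicalPhysics.QuantumLattice

open Matrix Finset Complex HubbardWave0 Literature.Probability.LatticeModels
open Literature.MathematicalPhysics.QuantumManyBody.StateRelaxation
open scoped ComplexOrder BigOperators

/-! ## The `B₁g` twist exponent -/

/-- The `B₁g` twist exponent `j(γ) ∈ {0, 1}`: `0` on `{1, R², σ, σR²}`, `1` on `{R, R³, σR, σR³}`
(`b1gSign γ = (−1)^{j(γ)}`). [cite: Scalapino1995, §2 eq. (2.3)] -/
def b1gTwist : DihedralGroup 4 → ℕ
  | DihedralGroup.r i => i.val % 2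
  | DihedralGroup.sr i => i.val % 2

/-- The carry of the character law: `j(γ₁) + j(γ₂) = j(γ₁γ₂) + 2·twistCarry γ₁ γ₂`. [cite: Scalapino1995, §2 eq. (2.3)] -/
def twistCarry (γ₁ γ₂ : DihedralGroup 4) : ℕ := (b1gTwist γ₁ + b1gTwist γ₂ - b1gTwist (γ₁ * γ₂)) / 2

/-- `j(γ) < 2`. [cite: Scalapino1995, §2 eq. (2.3)] -/
theorem b1gTwist_lt_two (γ : DihedralGroup 4) : b1gTwist γ < 2 := by
  cases γ <;> exact Nat.mod_lt _ (by norm_num)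

/-- **Character law with carry**: `j(γ₁) + j(γ₂) = j(γ₁γ₂) + 2·twistCarry γ₁ γ₂`. [cite: Scalapino1995, §2 eq. (2.3)] -/
theorem b1gTwist_add (γ₁ γ₂ : DihedralGroup 4) :
    b1gTwist γ₁ + b1gTwist γ₂ = b1gTwist (γ₁ * γ₂) + 2 * twistCarry γ₁ γ₂ := by
  revert γ₁ γ₂; unfold twistCarry; decide

/-- `twistCarry γ₁ γ₂ < 2`. [cite: Scalapino1995, §2 eq. (2.3)] -/
theorem twistCarry_lt_two (γ₁ γ₂ : DihedralGroup 4) : twistCarry γ₁ γ₂ < 2 := by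
  revert γ₁ γ₂; unfold twistCarry; decide

/-- `j(1) = 0`. [cite: Scalapino1995, §2 eq. (2.3)] -/
@[simp] theorem b1gTwist_one : b1gTwist (1 : DihedralGroup 4) = 0 := by decide

/-- `twistCarry γ 1 = 0`. [cite: Scalapino1995, §2 eq. (2.3)] -/
@[simp] theorem twistCarry_one_right (γ : DihedralGroup 4) : twistCarry γ 1 = 0 := by
  revert γ; unfold twistCarry; decide

/-- `b1gSign γ = (−1)^{j(γ)}`. [cite: Scalapino1995, §2 eq. (2.3)] -/
theorem b1gSign_eq_neg_one_pow_b1gTwist (γ : DihedralGroup 4) : b1gSign γ = (-1 : ℝ) ^ b1gTwist γ := by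
  cases γ with
  | r i => simp only [b1gSign, b1gTwist]; rw [← Nat.mod_add_div i.val 2, pow_add, pow_mul]; norm_num
  | sr i => simp only [b1gSign, b1gTwist]; rw [← Nat.mod_add_div i.val 2, pow_add, pow_mul]; norm_num

/-! ## The twisted space-group unitaries on the torus Fock space -/

section Torus

variable {L : ℕ} [NeZero L]

/-- (Local to this section.) [folklore] -/
local instance (priority := high) instDecidableEqFermionTorusTwist : DecidableEq (FermionTorus 2 L) :=
  LinearOrder.toDecidableEq

/-- Period four as a congruence: `a ≡ b (mod 4) ⇒ 𝒢_a = 𝒢_b`. [cite: BratteliRobinsonII1997, §5.2.2] -/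
theorem fockGauge_eq_of_mod_four_eq {ι : Type*} [Fintype ι] [LinearOrder ι] {a b : ℕ} (h : a % 4 = b % 4) :
    (fockGauge a : Matrix (Finset ι) (Finset ι) ℂ) = fockGauge b := by
  rw [← Nat.div_add_mod a 4, ← Nat.div_add_mod b 4, h, ← fockGauge_mul, ← fockGauge_mul, fockGauge_four_mul,
    fockGauge_four_mul]

/-- The twist exponent of a family member: `e(γ, m) = j(γ) + 2m`. [cite: BratteliRobinsonII1997, §5.2.2] -/
def twistExp (γ : DihedralGroup 4) (m : Fin 2) : ℕ := b1gTwist γ + 2 * m.val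

/-- **The gauge-twisted space-group unitaries** `T(v, γ, m) = U_v D_γ 𝒢_{j(γ) + 2m}`, indexed by
`((ℤ/L)² × S) × Fin 2`. [cite: BratteliRobinsonII1997, §6.2.4] -/
def twistedSpaceGroupUnitary (S : Finset (DihedralGroup 4)) :
    (TorusSite 2 L × ↥S) × Fin 2 → Matrix (Finset (Orb (FermionTorus 2 L))) (Finset (Orb (FermionTorus 2 L))) ℂ :=
  fun g => spaceGroupUnitary S g.1 * fockGauge (twistExp (g.1.2 : DihedralGroup 4) g.2)

/-- Unfolding. [cite: BratteliRobinsonII1997, §6.2.4] -/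
theorem twistedSpaceGroupUnitary_apply (S : Finset (DihedralGroup 4)) (g : (TorusSite 2 L × ↥S) × Fin 2) :
    twistedSpaceGroupUnitary S g = spaceGroupUnitary S g.1 * fockGauge (twistExp (g.1.2 : DihedralGroup 4) g.2) := rfl

/-- The translations and the point group conserve the particle number: `[N̂, U_v D_γ] = 0`.
[cite: BratteliRobinsonII1997, §5.2.2] -/
theorem commute_totalNumberOp_spaceGroupUnitary (S : Finset (DihedralGroup 4)) (g : TorusSite 2 L × ↥S) :
    Commute (totalNumberOp : Matrix (Finset (Orb (FermionTorus 2 L))) _ ℂ) (spaceGroupUnitary S g) := by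
  rw [totalNumberOp_eq_totalNumber]
  have hT : Commute (fockTranslate (L := L) g.1).val (totalNumber : Matrix (Finset (Orb (FermionTorus 2 L))) _ ℂ) :=
    fockRelabel_mapEquiv_commute_totalNumber _
  have hD : Commute (fockD4 (L := L) (g.2 : DihedralGroup 4)).val
      (totalNumber : Matrix (Finset (Orb (FermionTorus 2 L))) _ ℂ) := by
    rw [fockD4_apply, Orb.d4Perm_eq_mapEquiv]
    exact fockRelabel_mapEquiv_commute_totalNumber _
  exact (hT.mul_left hD).symm

/-- **The gauge rotation is central in the space group**: `𝒢_k (U_v D_γ) = (U_v D_γ) 𝒢_k`.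
[cite: BratteliRobinsonII1997, §5.2.2] -/
theorem fockGauge_commute_spaceGroupUnitary (S : Finset (DihedralGroup 4)) (g : TorusSite 2 L × ↥S) (k : ℕ) :
    Commute (fockGauge k) (spaceGroupUnitary S g) :=
  Commute.fockGauge_of_totalNumberOp (commute_totalNumberOp_spaceGroupUnitary S g) k

/-- Unitarity: `T(g)ᴴ T(g) = 1`. [cite: BratteliRobinsonII1997, §6.2.4] -/
theorem twistedSpaceGroupUnitary_conjTranspose_mul_self (S : Finset (DihedralGroup 4))
    (g : (TorusSite 2 L × ↥S) × Fin 2) :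
    (twistedSpaceGroupUnitary S g)ᴴ * twistedSpaceGroupUnitary S g = 1 := by
  have hU : (spaceGroupUnitary S g.1)ᴴ * spaceGroupUnitary S g.1 = 1 := d4Affine_conjTranspose_mul_self _ _
  rw [twistedSpaceGroupUnitary_apply, conjTranspose_mul, Matrix.mul_assoc,
    ← Matrix.mul_assoc (spaceGroupUnitary S g.1)ᴴ, hU, Matrix.one_mul, fockGauge_conjTranspose_mul_self]

/-- `T(g)` commutes with the `t–t'` Hubbard Hamiltonian. [cite: BratteliRobinsonII1997, §5.2.2] -/
theorem twistedSpaceGroupUnitary_mul_hubbardTorusTT' (S : Finset (DihedralGroup 4)) (t t' U : ℝ)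
    (g : (TorusSite 2 L × ↥S) × Fin 2) :
    twistedSpaceGroupUnitary S g * hubbardTorusTT' L t t' U = hubbardTorusTT' L t t' U * twistedSpaceGroupUnitary S g := by
  have hG : Commute (fockGauge (twistExp (g.1.2 : DihedralGroup 4) g.2)) (hubbardTorusTT' L t t' U) := by
    refine Commute.fockGauge_of_totalNumberOp ?_ _
    rw [totalNumberOp_eq_totalNumber]
    exact (hubbardTorusTT'_commute_totalNumber L t t' U).symm
  rw [twistedSpaceGroupUnitary_apply, Matrix.mul_assoc, hG.eq, ← Matrix.mul_assoc,
    spaceGroupUnitary_mul_hubbardTorusTT', Matrix.mul_assoc]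

omit [NeZero L] in
/-- `n_{yσ}` conserves the particle number. [cite: BratteliRobinsonII1997, §5.2.2] -/
theorem commute_totalNumberOp_numberOp (y : FermionTorus 2 L) (σ : Fin 2) :
    Commute (totalNumberOp : Matrix (Finset (Orb (FermionTorus 2 L))) _ ℂ) (numberOp y σ) :=
  Commute.sum_left _ _ _ fun i _ => numberAt_commute i (orb y σ)

/-- `T(g)` commutes with `N_σ = Σ_y n_{yσ}`. [cite: BratteliRobinsonII1997, §5.2.2] -/
theorem twistedSpaceGroupUnitary_commute_spinNumber (S : Finset (DihedralGroup 4))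
    (g : (TorusSite 2 L × ↥S) × Fin 2) (σ : Fin 2) :
    twistedSpaceGroupUnitary S g * (∑ y : FermionTorus 2 L, numberOp y σ) =
      (∑ y : FermionTorus 2 L, numberOp y σ) * twistedSpaceGroupUnitary S g := by
  have hN : Commute (totalNumberOp : Matrix (Finset (Orb (FermionTorus 2 L))) _ ℂ)
      (∑ y : FermionTorus 2 L, numberOp y σ) :=
    Commute.sum_right (Finset.univ : Finset (FermionTorus 2 L)) (fun y => numberOp y σ) totalNumberOp
      fun y _ => commute_totalNumberOp_numberOp y σ
  have hG : Commute (fockGauge (twistExp (g.1.2 : DihedralGroup 4) g.2))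
      (∑ y : FermionTorus 2 L, numberOp y σ : Matrix (Finset (Orb (FermionTorus 2 L))) _ ℂ) :=
    Commute.fockGauge_of_totalNumberOp hN _
  rw [twistedSpaceGroupUnitary_apply, Matrix.mul_assoc, hG.eq, ← Matrix.mul_assoc,
    spaceGroupUnitary_commute_spinNumber, Matrix.mul_assoc]

/-- The space-group product formula: `(U_w D_γ)(U_{w₀} D_{γ₀}) = U_{w + γw₀} D_{γγ₀}`. [cite: Han2020Bootstrap, §3] -/
theorem spaceGroupUnitary_mul_affine {S : Finset (DihedralGroup 4)} (hmul : ∀ a ∈ S, ∀ b ∈ S, a * b ∈ S)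
    (g : TorusSite 2 L × ↥S) (w₀ : TorusSite 2 L) {γ₀ : DihedralGroup 4} (hγ₀ : γ₀ ∈ S) :
    spaceGroupUnitary S g * ((fockTranslate w₀).val * (fockD4 (L := L) γ₀).val) =
      spaceGroupUnitary S (g.1 + d4Site (g.2 : DihedralGroup 4) w₀, ⟨(g.2 : DihedralGroup 4) * γ₀, hmul _ g.2.2 _ hγ₀⟩) := by
  show (fockTranslate g.1).val * (fockD4 (L := L) (g.2 : DihedralGroup 4)).val *
      ((fockTranslate w₀).val * (fockD4 (L := L) γ₀).val) =
    (fockTranslate (g.1 + d4Site (g.2 : DihedralGroup 4) w₀)).val *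
      (fockD4 (L := L) ((g.2 : DihedralGroup 4) * γ₀)).val
  rw [fockTranslate_add, map_mul]
  show _ = (fockTranslate g.1).val * (fockTranslate (d4Site (g.2 : DihedralGroup 4) w₀)).val *
      ((fockD4 (L := L) (g.2 : DihedralGroup 4)).val * (fockD4 (L := L) γ₀).val)
  rw [Matrix.mul_assoc, ← Matrix.mul_assoc (fockD4 (L := L) (g.2 : DihedralGroup 4)).val,
    fockD4_val_mul_fockTranslate_val]
  simp only [Matrix.mul_assoc]

/-- The index map of right multiplication by the member `((w₀, γ₀), m₀)`. [cite: Han2020Bootstrap, §3] -/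
def twistMulIndex {S : Finset (DihedralGroup 4)} (hmul : ∀ a ∈ S, ∀ b ∈ S, a * b ∈ S)
    (w₀ : TorusSite 2 L) {γ₀ : DihedralGroup 4} (hγ₀ : γ₀ ∈ S) (m₀ : Fin 2)
    (g : (TorusSite 2 L × ↥S) × Fin 2) : (TorusSite 2 L × ↥S) × Fin 2 :=
  ((g.1.1 + d4Site (g.1.2 : DihedralGroup 4) w₀, ⟨(g.1.2 : DihedralGroup 4) * γ₀, hmul _ g.1.2.2 _ hγ₀⟩),
    ⟨(g.2.val + m₀.val + twistCarry (g.1.2 : DihedralGroup 4) γ₀) % 2, Nat.mod_lt _ (by norm_num)⟩)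

omit [NeZero L] in
/-- The index map is injective. [cite: Han2020Bootstrap, §3] -/
theorem twistMulIndex_injective {S : Finset (DihedralGroup 4)} (hmul : ∀ a ∈ S, ∀ b ∈ S, a * b ∈ S)
    (w₀ : TorusSite 2 L) {γ₀ : DihedralGroup 4} (hγ₀ : γ₀ ∈ S) (m₀ : Fin 2) :
    Function.Injective (twistMulIndex (L := L) hmul w₀ hγ₀ m₀) := by
  rintro ⟨⟨w, γ, hγ⟩, m⟩ ⟨⟨w', γ', hγ'⟩, m'⟩ h
  simp only [twistMulIndex, Prod.mk.injEq, Subtype.mk.injEq, Fin.mk.injEq] at h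
  obtain ⟨⟨h1, h2⟩, h3⟩ := h
  have hγγ : γ = γ' := mul_right_cancel h2
  subst hγγ
  have hw : w = w' := add_right_cancel h1
  subst hw
  have hm : m = m' := by
    have hm2 : m.val % 2 = m'.val % 2 := by omega
    exact Fin.ext (by rw [Nat.mod_eq_of_lt m.isLt, Nat.mod_eq_of_lt m'.isLt] at hm2; exact hm2)
  subst hm
  rfl

omit [NeZero L] in
/-- The twist exponents add up modulo four under the index map. [cite: Han2020Bootstrap, §3] -/
theorem twistExp_add_mod_four {S : Finset (DihedralGroup 4)} (hmul : ∀ a ∈ S, ∀ b ∈ S, a * b ∈ S)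
    (w₀ : TorusSite 2 L) {γ₀ : DihedralGroup 4} (hγ₀ : γ₀ ∈ S) (m₀ : Fin 2)
    (g : (TorusSite 2 L × ↥S) × Fin 2) :
    (twistExp (g.1.2 : DihedralGroup 4) g.2 + twistExp γ₀ m₀) % 4 =
      twistExp ((twistMulIndex (L := L) hmul w₀ hγ₀ m₀ g).1.2 : DihedralGroup 4)
        (twistMulIndex (L := L) hmul w₀ hγ₀ m₀ g).2 % 4 := by
  have hadd := b1gTwist_add (g.1.2 : DihedralGroup 4) γ₀
  simp only [twistExp, twistMulIndex]
  omega

/-- **Closure of the twisted family under right multiplication by a member** (`S` closed under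
multiplication, `γ₀ ∈ S`): `T(g) T((w₀, γ₀), m₀) = T(σ g)` for a permutation `σ` of the index set.
[cite: Han2020Bootstrap, §3] -/
theorem twistedSpaceGroupUnitary_closed {S : Finset (DihedralGroup 4)} (hmul : ∀ a ∈ S, ∀ b ∈ S, a * b ∈ S)
    (w₀ : TorusSite 2 L) {γ₀ : DihedralGroup 4} (hγ₀ : γ₀ ∈ S) (m₀ : Fin 2) :
    ∃ σ : ((TorusSite 2 L × ↥S) × Fin 2) ≃ ((TorusSite 2 L × ↥S) × Fin 2), ∀ g,
      twistedSpaceGroupUnitary S g * twistedSpaceGroupUnitary S ((w₀, ⟨γ₀, hγ₀⟩), m₀) =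
        twistedSpaceGroupUnitary S (σ g) := by
  refine ⟨Equiv.ofBijective _ (Finite.injective_iff_bijective.mp (twistMulIndex_injective (L := L) hmul w₀ hγ₀ m₀)),
    fun g => ?_⟩
  rw [Equiv.ofBijective_apply, twistedSpaceGroupUnitary_apply, twistedSpaceGroupUnitary_apply,
    twistedSpaceGroupUnitary_apply]
  -- move the first gauge factor past the second space-group unitary, multiply gauge factors
  rw [Matrix.mul_assoc, ← Matrix.mul_assoc (fockGauge _) (spaceGroupUnitary S _),
    (fockGauge_commute_spaceGroupUnitary S _ _).eq, Matrix.mul_assoc, fockGauge_mul, ← Matrix.mul_assoc,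
    fockGauge_eq_of_mod_four_eq (twistExp_add_mod_four (L := L) hmul w₀ hγ₀ m₀ g)]
  congr 1
  exact spaceGroupUnitary_mul_affine hmul g.1 w₀ hγ₀

/-- **Closure under translations** (`1 ∈ S`): `T(g) U_v = T(σ g)`. [cite: Han2020Bootstrap, §3] -/
theorem twistedSpaceGroupUnitary_closed_translate {S : Finset (DihedralGroup 4)} (h1 : (1 : DihedralGroup 4) ∈ S)
    (hmul : ∀ a ∈ S, ∀ b ∈ S, a * b ∈ S) (v : TorusSite 2 L) :
    ∃ σ : ((TorusSite 2 L × ↥S) × Fin 2) ≃ ((TorusSite 2 L × ↥S) × Fin 2), ∀ g,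
      twistedSpaceGroupUnitary S g * (fockTranslate v).val = twistedSpaceGroupUnitary S (σ g) := by
  obtain ⟨σ, hσ⟩ := twistedSpaceGroupUnitary_closed (L := L) hmul v h1 0
  refine ⟨σ, fun g => ?_⟩
  have h := hσ g
  have he : twistExp (1 : DihedralGroup 4) (0 : Fin 2) = 0 := by
    simp only [twistExp, b1gTwist_one, Fin.val_zero, mul_zero, add_zero]
  have hsg : spaceGroupUnitary S (v, ⟨1, h1⟩) = (fockTranslate v).val := by
    show (fockTranslate v).val * (fockD4 (L := L) (1 : DihedralGroup 4)).val = _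
    rw [map_one, show ((1 : Matrix.unitaryGroup (Finset (Orb (FermionTorus 2 L))) ℂ).val :
      Matrix (Finset (Orb (FermionTorus 2 L))) (Finset (Orb (FermionTorus 2 L))) ℂ) = 1 from rfl, Matrix.mul_one]
  have h0 : twistedSpaceGroupUnitary S ((v, ⟨1, h1⟩), (0 : Fin 2)) = (fockTranslate v).val := by
    rw [twistedSpaceGroupUnitary_apply]
    show spaceGroupUnitary S (v, ⟨1, h1⟩) * fockGauge (twistExp (1 : DihedralGroup 4) (0 : Fin 2)) = _
    rw [he, fockGauge_zero, Matrix.mul_one, hsg]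
  calc twistedSpaceGroupUnitary S g * (fockTranslate v).val
      = twistedSpaceGroupUnitary S g * twistedSpaceGroupUnitary S ((v, ⟨1, h1⟩), (0 : Fin 2)) := by rw [h0]
    _ = twistedSpaceGroupUnitary S (σ g) := h

end Torus

end Literature.MathematicalPhysics.QuantumLattice

end
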